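import Literature.AlgebraicGeometry.AbelianSchemes.PolarizationHatLevelStructure
import Literature.AlgebraicGeometry.AbelianSchemes.AbelianSchemeQuotientMulNDescent
import Literature.AlgebraicGeometry.AbelianSchemes.RigidifiedPicZeroFamiliesOfReducedBase
import Mathlib.AlgebraicGeometry.Morphisms.Etale
import HarnessLib

/-!
# The kernel pair of an étale polarisation of type `δ` is killed by `[∏ δᵢ]`

Topic `Literature/AlgebraicGeometry/AbelianSchemes`; theorems only (no definition, no named fact, no instance). Let
`A → S` be an abelian scheme with dual pair `D` and a polarisation `λ : A → Â` of TYPE `δ` ([MumfordFogartyKirwan1994]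
App. 7A; the tree's `Polarization.HasType δ`), and put `e := ∏ᵢ δᵢ`.

* `pow_prod_eq_of_comp_lam_eq` — POINTWISE: two `Ω`-points `x₁, x₂` of a geometric fibre `A_s` with `λ(x₁) = λ(x₂)`
  satisfy `x₁ᵉ = x₂ᵉ` (their quotient lies in `ker λ̄_s ≅ (∏ ℤ/δᵢ)²`, which is killed by `e`; the tree's
  `HasType.pow_prod_eq_one_of_comp_lam_eq_one`);
* **`fst_comp_mulN_eq_snd_comp_mulN`** — the KERNEL PAIR: for `λ` étale and `S` reduced locally Noetherian, the two
  projections `A ×_Â A ⇉ A` become equal after `[e] : A → A`.  The kernel pair is étale over `A`, hence smooth over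
  the reduced `S`, hence reduced (Stacks 034E); two morphisms from a reduced scheme to the separated `S`-scheme `A`
  agreeing on geometric points are equal (the tree's `eq_of_forall_geometricPoint_comp_eq`), and pointwise this is the
  first item;
* **`comp_mulN_eq_of_comp_lam_eq`** — hence for EVERY scheme `Z` and `g₁, g₂ : Z → A` with `g₁ ≫ λ = g₂ ≫ λ`:
  `g₁ ≫ [e] = g₂ ≫ [e]` (factor `(g₁, g₂)` through the kernel pair).

Consumer (cell `hodgecm-mathlib`, Hecke-link socket (B), (cov-3B)): the hypothesis `hv` of the quasi-inverse
`μ : Â → A` of `λ` by fpqc descent (`AbelianSchemes/PolarizationQuasiInverse`), `[e]_A` being `λ`-invariant on the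
kernel pair. HC_CM is proved only modulo the 7 printed citations until rung 0 closes.

## References
* [MumfordFogartyKirwan1994] D. Mumford, J. Fogarty, F. Kirwan, *Geometric Invariant Theory*, 3rd ed., App. 7A
  (pp. 234–235), Ch. 6 §1 Cor. 6.5 (p. 117).
* [MumfordAV1970] D. Mumford, *Abelian Varieties*, §7 Thm. 4 (p. 72), §23 (p. 231).
* [StacksProject] The Stacks Project, Tag 034E (smooth over reduced is reduced).
-/

noncomputable section

-- `(A.X ⊗ B.X).left`-style identifications hold by `rfl` only (as in the tree's abelian-scheme files).
set_option backward.isDefEq.respectTransparency false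

universe u

open CategoryTheory CategoryTheory.Limits AlgebraicGeometry MonoidalCategory CartesianMonoidalCategory
open scoped MonObj

namespace Literature.AlgebraicGeometry.AbelianSchemes

namespace AbelianSchemeOver

namespace Polarization

variable {S : Scheme.{u}} {A : AbelianSchemeOver S} {D : A.DualPair} (pol : A.Polarization D)
  {g : ℕ} {δ : Fin g → ℕ}

/-! ## §1 Pointwise -/

/-- **Two `Ω`-points of a geometric fibre with the same image under `λ` have the same `e`-th power**, `e = ∏ᵢ δᵢ`
(their quotient lies in `ker λ̄_s ≅ (∏ᵢ ℤ/δᵢ)²`, killed by `e`; `A` commutative). [cite: MumfordFogartyKirwan1994,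
App. 7A (pp. 234–235)] [cite: MumfordAV1970, §7 Thm. 4 (p. 72)] -/
theorem pow_prod_eq_of_comp_lam_eq [IsCommMonObj A.X] (hT : pol.HasType δ) ⦃Ω : Type u⦄ [Field Ω]
    [IsAlgClosed Ω] (s : Spec (.of Ω) ⟶ S) (x₁ x₂ : A.FibrePoints s) (h : x₁ ≫ pol.lam = x₂ ≫ pol.lam) :
    x₁ ^ (∏ i, δ i) = x₂ ^ (∏ i, δ i) := by
  haveI := pol.isMonHom
  have hy : (x₁ / x₂) ≫ pol.lam = 1 := by
    rw [GrpObj.div_comp, h, div_self']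
  have hpow := hT.pow_prod_eq_one_of_comp_lam_eq_one s (x₁ / x₂) hy
  rwa [div_pow, div_eq_one] at hpow

/-! ## §2 The kernel pair -/

/-- Restriction of a power to the total space: `(xⁿ).left = x.left ≫ [n].left` for a `T`-valued point
`x : Over.mk f ⟶ A` (Mathlib `MonObj.comp_pow`). [cite: MumfordFogartyKirwan1994, Ch. 6 §1 (p. 115)] -/
private theorem pow_left {T : Scheme.{u}} {f : T ⟶ S} (x : Over.mk f ⟶ A.X) (n : ℕ) :
    (x ^ n).left = x.left ≫ (A.mulN n).left := by
  rw [mulN_def, ← Over.comp_left, MonObj.comp_pow, Category.comp_id]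

/-- **The two projections of the kernel pair `A ×_Â A ⇉ A` of an ÉTALE polarisation of type `δ` agree after `[∏ δᵢ]`**
(`S` reduced and locally Noetherian).  The kernel pair is étale over `A`, hence smooth over the reduced `S`, hence
reduced (Stacks 034E); morphisms from a reduced scheme to the separated `S`-scheme `A` agreeing on geometric points
are equal, and on geometric points this is `pow_prod_eq_of_comp_lam_eq`. [cite: MumfordFogartyKirwan1994, App. 7A
(pp. 234–235)] [cite: StacksProject, Tag 034E] -/
theorem fst_comp_mulN_eq_snd_comp_mulN [Etale pol.lam.left] [IsReduced S] [IsLocallyNoetherian S]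
    (hT : pol.HasType δ) :
    pullback.fst pol.lam.left pol.lam.left ≫ (A.mulN (∏ i, δ i)).left =
      pullback.snd pol.lam.left pol.lam.left ≫ (A.mulN (∏ i, δ i)).left := by
  haveI := pol.isMonHom
  haveI : IsCommMonObj A.X := A.isCommMonObj_of_isReduced_base
  haveI := A.isProper
  haveI := A.isSmooth
  -- the kernel pair is reduced: `snd` is étale (a base change of `λ`), `A → S` is smooth, `S` is reduced
  haveI : Etale (pullback.snd pol.lam.left pol.lam.left) :=
    MorphismProperty.pullback_snd _ _ ‹Etale pol.lam.left›
  haveI : IsReduced (pullback pol.lam.left pol.lam.left) :=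
    Literature.AlgebraicGeometry.Resolution.isReduced_of_smooth_of_isReduced_base
      (pullback.snd pol.lam.left pol.lam.left ≫ A.X.hom)
  refine eq_of_forall_geometricPoint_comp_eq A.X.hom ?_ fun Ω _ _ t => ?_
  · -- both composites lie over `S`
    rw [Category.assoc, Category.assoc, Over.w (A.mulN (∏ i, δ i)), ← pol.lam_comp_hom, pullback.condition_assoc]
  · -- at a geometric point `t` of the kernel pair: two points of `A_s` with the same `λ`
    have hs : (t ≫ pullback.snd pol.lam.left pol.lam.left) ≫ A.X.hom =
        (t ≫ pullback.fst pol.lam.left pol.lam.left) ≫ A.X.hom := by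
      rw [Category.assoc, Category.assoc, ← pol.lam_comp_hom, pullback.condition_assoc]
    let x₁ : A.FibrePoints ((t ≫ pullback.fst pol.lam.left pol.lam.left) ≫ A.X.hom) :=
      Over.homMk (t ≫ pullback.fst pol.lam.left pol.lam.left) rfl
    let x₂ : A.FibrePoints ((t ≫ pullback.fst pol.lam.left pol.lam.left) ≫ A.X.hom) :=
      Over.homMk (t ≫ pullback.snd pol.lam.left pol.lam.left) hs
    have h12 : x₁ ≫ pol.lam = x₂ ≫ pol.lam := by
      ext
      change (t ≫ pullback.fst pol.lam.left pol.lam.left) ≫ pol.lam.left =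
        (t ≫ pullback.snd pol.lam.left pol.lam.left) ≫ pol.lam.left
      rw [Category.assoc, Category.assoc, pullback.condition]
    have hp := congrArg (fun x : A.FibrePoints _ => x.left) (pol.pow_prod_eq_of_comp_lam_eq hT _ x₁ x₂ h12)
    simp only [pow_left] at hp
    exact hp

/-! ## §3 Every pair of maps equalised by `λ` -/

/-- **`λ`-equalised maps are `[∏ δᵢ]`-equalised**: for an étale polarisation `λ` of type `δ` over a reduced locally
Noetherian base, any `g₁, g₂ : Z → A` with `g₁ ≫ λ = g₂ ≫ λ` satisfy `g₁ ≫ [∏ δᵢ] = g₂ ≫ [∏ δᵢ]` (factor through the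
kernel pair). [cite: MumfordFogartyKirwan1994, App. 7A (pp. 234–235)] [cite: MumfordAV1970, §7 Thm. 4 (p. 72)] -/
theorem comp_mulN_eq_of_comp_lam_eq [Etale pol.lam.left] [IsReduced S] [IsLocallyNoetherian S]
    (hT : pol.HasType δ) {Z : Scheme.{u}} (g₁ g₂ : Z ⟶ A.X.left) (h : g₁ ≫ pol.lam.left = g₂ ≫ pol.lam.left) :
    g₁ ≫ (A.mulN (∏ i, δ i)).left = g₂ ≫ (A.mulN (∏ i, δ i)).left := by
  have key := pol.fst_comp_mulN_eq_snd_comp_mulN hT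
  calc g₁ ≫ (A.mulN (∏ i, δ i)).left
      = pullback.lift g₁ g₂ h ≫ pullback.fst pol.lam.left pol.lam.left ≫ (A.mulN (∏ i, δ i)).left := by
        rw [pullback.lift_fst_assoc]
    _ = pullback.lift g₁ g₂ h ≫ pullback.snd pol.lam.left pol.lam.left ≫ (A.mulN (∏ i, δ i)).left := by rw [key]
    _ = g₂ ≫ (A.mulN (∏ i, δ i)).left := by rw [pullback.lift_snd_assoc]

end Polarization

end AbelianSchemeOver

end Literature.AlgebraicGeometry.AbelianSchemes
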